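import Literature.Probability.LatticeModels.CollarLegModelStrands
import Literature.Probability.Percolation.FKFreeLoopRepresentation

/-!
# The medial strand representation of the collar leg model, II: frozen matching and the
# Baxter–Kelland–Wu factorisation of the weight over bond configurations

Sequel of `CollarLegModelStrands.lean` (tracked corners, completed configurations, turn factors,
the six-vertex split at live edges) for `Literature.Probability.LatticeModels.CollarLegModel`
[BaxterKellandWu1976, §3–§4]. Proved here, for an ARBITRARY collar leg model `M`:

* `frozenWeight_eq_turnFactor` — at a frozen edge, read in any configuration whose state on that
  edge is its frozen state, the frozen weight (rules (C), (D1), (D2)) is the product of the turn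
  factors of the two arriving corners `cIn e`, `cOut e`;
* `prod_cornerSet_turnFactor` — the product of the turn factors over all corners over the piece
  (`Percolation.cornerSet (piece M)`) regrouped over the edges at the vertex-cells;
* `weight_eq_sum_prod_turnFactor` — **the BKW factorisation**: for a height configuration with
  unit differences around every live edge,
  `weight h = Σ_{ω ⊆ E} ∏_{c ∈ cornerSet (piece M)} turnFactor h (cfgOf ω) c`;
* `Z_eq_sum_prod_turnFactor` — hence `Z = Σ_{ω ⊆ E} Σ_h ∏_c turnFactor h (cfgOf ω) c`, the
  starting point of the strand expansion of `Zins` (insertion dictionary D2 of cruxes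
  `BoundaryDefectGaussianR` / `DensityIntegration` of `CardyFormulaZ2`).

The unit-difference hypothesis holds for every valid configuration of the closed collar and of
the jump collar of an admissible leg insertion (validity at corners with a free cell; the level
profile of the walk at the remaining ones); it is kept explicit here.

## References

* R. J. Baxter, S. B. Kelland, F. Y. Wu, J. Phys. A 9 (1976) 397–406, §3–§4. [BaxterKellandWu1976]
-/

namespace Literature.Probability.LatticeModels

namespace CollarLegModel

open Finset

/-! ### Frozen matching -/

section Frozen

variable (M : CollarLegModel)

/-- The coding of lattice edges by `Sym2 (Site 2)` is injective. [folklore] -/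
theorem edgeSym2_injective : Function.Injective edgeSym2 := by
  rintro ⟨u, b⟩ ⟨v, c⟩ h
  rw [edgeSym2, edgeSym2] at h
  rcases Sym2.eq_iff.1 h with ⟨h1, h2⟩ | ⟨h1, h2⟩
  · have hu : u = v := toSite_inj.1 h1
    subst hu
    have h3 := toSite_inj.1 h2
    revert h3
    cases b <;> cases c <;> simp [SixVertex.edgeTip]
  · have h3 := toSite_inj.1 h1
    have h4 := toSite_inj.1 h2
    revert h3 h4
    cases b <;> cases c <;> simp [SixVertex.edgeTip, Prod.ext_iff] <;> omega

/-- `cIn e` targets a live edge iff `e` is live. [folklore] -/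
theorem targetsLive_cIn_iff (e : (ℤ × ℤ) × Bool) : M.TargetsLive (cIn e) ↔ e ∈ M.E := by
  rw [TargetsLive, cTgt_cIn, mem_image]
  constructor
  · rintro ⟨e', he', h⟩
    rwa [← edgeSym2_injective h]
  · exact fun h => ⟨e, h, rfl⟩

/-- `cOut e` targets a live edge iff `e` is live. [folklore] -/
theorem targetsLive_cOut_iff (e : (ℤ × ℤ) × Bool) : M.TargetsLive (cOut e) ↔ e ∈ M.E := by
  rw [TargetsLive, cTgt_cOut, ← cTgt_cIn, ← TargetsLive, targetsLive_cIn_iff]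

/-- **Frozen matching, open edge**: the weight (D2) of a frozen open edge is the product of the
turn factors of its two arriving corners (each level line follows the edge inside its side face).
[cite: BaxterKellandWu1976, §4] -/
theorem openWeight_eq_turnFactor (h : ↥M.freeCells → ℤ) {e : (ℤ × ℤ) × Bool} (he : e ∉ M.E)
    {β : Percolation.BondConfig (Site 2)} (hβ : edgeSym2 e ∈ β) :
    M.openWeight h e = M.turnFactor h β (cIn e) * M.turnFactor h β (cOut e) := by
  classical
  have hIn : cTgt (cIn e) ∈ β := by rwa [cTgt_cIn]
  have hOut : cTgt (cOut e) ∈ β := by rwa [cTgt_cOut]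
  have nIn : ¬M.TargetsLive (cIn e) := by rwa [targetsLive_cIn_iff]
  have nOut : ¬M.TargetsLive (cOut e) := by rwa [targetsLive_cOut_iff]
  have e1 : M.turnFactor h β (cIn e) = M.openFactor h e (SixVertex.leftFace e false) := by
    rw [turnFactor, if_pos hIn, nextCorner_of_mem hIn, openFactor]
    simp only [IsTracked, ofSite_cIn_fst, ofSite_cFace_cIn, ofSite_cIn_fst_add, ofSite_cFace_cIn_open, nIn, if_false]
    by_cases H : SixVertex.leftFace e false ∈ M.faceCells ∧ e.1 ∈ M.vertexCells ∧
        SixVertex.edgeTip e ∈ M.vertexCells ∧ M.hv h e.1 = M.hv h (SixVertex.edgeTip e)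
    · rw [if_pos H, if_pos ⟨⟨H.2.1, H.1⟩, ⟨H.2.2.1, H.1⟩, H.2.2.2⟩]
    · rw [if_neg H, if_neg (fun H' => H ⟨H'.1.2, H'.1.1, H'.2.1.1, H'.2.2⟩)]
  have e2 : M.turnFactor h β (cOut e) = M.openFactor h e (SixVertex.leftFace e true) := by
    rw [turnFactor, if_pos hOut, nextCorner_of_mem hOut, openFactor]
    simp only [IsTracked, ofSite_cOut_fst, ofSite_cFace_cOut, ofSite_cOut_fst_add, ofSite_cFace_cOut_open, nOut, if_false]
    by_cases H : SixVertex.leftFace e true ∈ M.faceCells ∧ e.1 ∈ M.vertexCells ∧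
        SixVertex.edgeTip e ∈ M.vertexCells ∧ M.hv h e.1 = M.hv h (SixVertex.edgeTip e)
    · rw [if_pos H, if_pos ⟨⟨H.2.2.1, H.1⟩, ⟨H.2.1, H.1⟩, H.2.2.2.symm⟩, H.2.2.2]
    · rw [if_neg H, if_neg (fun H' => H ⟨H'.1.2, H'.2.1.1, H'.1.1, H'.2.2.symm⟩)]
  rw [e1, e2, openWeight, mul_comm]

/-- **Frozen matching, closed edge**: the weight (C)/(D1) of a frozen closed edge is the product
of the turn factors of its two arriving corners (each level line crosses the edge around its
endpoint; an endpoint that is not a cell contributes `1` on both sides). [cite: BaxterKellandWu1976, §4] -/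
theorem closedWeight_eq_turnFactor (h : ↥M.freeCells → ℤ) {e : (ℤ × ℤ) × Bool} (he : e ∉ M.E)
    {β : Percolation.BondConfig (Site 2)} (hβ : edgeSym2 e ∉ β) :
    M.closedWeight h e = M.turnFactor h β (cIn e) * M.turnFactor h β (cOut e) := by
  classical
  have hIn : cTgt (cIn e) ∉ β := by rwa [cTgt_cIn]
  have hOut : cTgt (cOut e) ∉ β := by rwa [cTgt_cOut]
  have nIn : ¬M.TargetsLive (cIn e) := by rwa [targetsLive_cIn_iff]
  have nOut : ¬M.TargetsLive (cOut e) := by rwa [targetsLive_cOut_iff]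
  have e1 : M.turnFactor h β (cIn e) = M.closedFactor h e e.1 := by
    rw [turnFactor, if_neg hIn, nextCorner_of_not_mem hIn, closedFactor]
    simp only [IsTracked, ofSite_cIn_fst, ofSite_cFace_cIn, ofSite_cFace_cIn_succ, nIn, if_false]
    by_cases H : e.1 ∈ M.vertexCells ∧ SixVertex.leftFace e true ∈ M.faceCells ∧
        SixVertex.leftFace e false ∈ M.faceCells ∧ M.hf h (SixVertex.leftFace e true) = M.hf h (SixVertex.leftFace e false)
    · rw [if_pos H, if_pos ⟨⟨H.1, H.2.2.1⟩, ⟨H.1, H.2.1⟩, H.2.2.2.symm⟩, H.2.2.2]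
    · rw [if_neg H, if_neg (fun H' => H ⟨H'.1.1, H'.2.1.2, H'.1.2, H'.2.2.symm⟩)]
  have e2 : M.turnFactor h β (cOut e) = M.closedFactor h e (SixVertex.edgeTip e) := by
    rw [turnFactor, if_neg hOut, nextCorner_of_not_mem hOut, closedFactor]
    simp only [IsTracked, ofSite_cOut_fst, ofSite_cFace_cOut, ofSite_cFace_cOut_succ, nOut, if_false]
    by_cases H : SixVertex.edgeTip e ∈ M.vertexCells ∧ SixVertex.leftFace e true ∈ M.faceCells ∧
        SixVertex.leftFace e false ∈ M.faceCells ∧ M.hf h (SixVertex.leftFace e true) = M.hf h (SixVertex.leftFace e false)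
    · rw [if_pos H, if_pos ⟨⟨H.1, H.2.1⟩, ⟨H.1, H.2.2.1⟩, H.2.2.2⟩]
    · rw [if_neg H, if_neg (fun H' => H ⟨H'.1.1, H'.1.2, H'.2.1.2, H'.2.2⟩)]
  rw [e1, e2, closedWeight]

/-- **Frozen matching**: for every frozen edge, read in a configuration whose state on that edge
is its frozen state (open iff it is a spoke or ghost edge), the frozen weight is the product of
the turn factors of the two arriving corners. [cite: BaxterKellandWu1976, §4] -/
theorem frozenWeight_eq_turnFactor (h : ↥M.freeCells → ℤ) {e : (ℤ × ℤ) × Bool} (he : e ∈ M.frozenEdges)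
    {β : Percolation.BondConfig (Site 2)} (hβ : edgeSym2 e ∈ β ↔ e ∈ M.openEdges) :
    M.frozenWeight h e = M.turnFactor h β (cIn e) * M.turnFactor h β (cOut e) := by
  have heE : e ∉ M.E := (mem_sdiff.1 he).2
  rw [frozenWeight]
  by_cases ho : e ∈ M.openEdges
  · rw [if_pos ho, M.openWeight_eq_turnFactor h heE (hβ.2 ho)]
  · rw [if_neg ho, M.closedWeight_eq_turnFactor h heE (fun hb => ho (hβ.1 hb))]

end Frozen

/-! ### Weight factorisation over bond configurations -/

section Factorisation

variable (M : CollarLegModel)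

/-- Membership in the completed configuration: a coded edge is present iff it is in `ω` or frozen open. [folklore] -/
theorem edgeSym2_mem_cfgOf_iff (ω : Finset ((ℤ × ℤ) × Bool)) (e : (ℤ × ℤ) × Bool) :
    edgeSym2 e ∈ M.cfgOf ω ↔ e ∈ ω ∨ e ∈ M.openEdges := by
  rw [cfgOf, Finset.mem_coe, mem_image]
  constructor
  · rintro ⟨e', he', h⟩
    rw [← edgeSym2_injective h]; exact mem_union.1 he'
  · exact fun h => ⟨e, mem_union.2 h, rfl⟩

/-- Live edges are edges at the vertex-cells. [folklore] -/
theorem E_subset_edges : M.E ⊆ SixVertex.edges M.vertexCells := fun e he => by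
  rw [E, inducedEdges, mem_filter] at he
  exact (SixVertex.mem_edges_iff _ _).2 (Or.inl (mem_union_left _ he.2.1))

/-- A live edge is not frozen open. [folklore] -/
theorem not_mem_openEdges_of_mem_E {e : (ℤ × ℤ) × Bool} (he : e ∈ M.E) : e ∉ M.openEdges := fun ho => by
  have := (mem_filter.1 ho).1
  rw [frozenEdges, mem_sdiff] at this
  exact this.2 he

/-- The turn factor of `cIn e` at a vertex that is not a cell is `1`. [folklore] -/
theorem turnFactor_cIn_eq_one (h : ↥M.freeCells → ℤ) (β : Percolation.BondConfig (Site 2)) {e : (ℤ × ℤ) × Bool}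
    (he : e.1 ∉ M.vertexCells) : M.turnFactor h β (cIn e) = 1 := by
  classical
  have nt : ¬M.IsTracked (cIn e) := fun ht => he (by simpa using ht.1)
  have nl : ¬M.TargetsLive (cIn e) := fun hl => by
    rw [targetsLive_cIn_iff] at hl
    rw [E, inducedEdges, mem_filter] at hl
    exact he (mem_union_left _ hl.2.1)
  unfold turnFactor
  split_ifs with h1 h2 h3 <;> first | rfl | exact absurd h2.1 nt | exact absurd h3.1 nt

/-- The turn factor of `cOut e` at a far endpoint that is not a cell is `1`. [folklore] -/
theorem turnFactor_cOut_eq_one (h : ↥M.freeCells → ℤ) (β : Percolation.BondConfig (Site 2)) {e : (ℤ × ℤ) × Bool}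
    (he : SixVertex.edgeTip e ∉ M.vertexCells) : M.turnFactor h β (cOut e) = 1 := by
  classical
  have nt : ¬M.IsTracked (cOut e) := fun ht => he (by simpa using ht.1)
  have nl : ¬M.TargetsLive (cOut e) := fun hl => by
    rw [targetsLive_cOut_iff] at hl
    rw [E, inducedEdges, mem_filter] at hl
    exact he (mem_union_left _ hl.2.2)
  unfold turnFactor
  split_ifs with h1 h2 h3 <;> first | rfl | exact absurd h2.1 nt | exact absurd h3.1 nt

/-- The corners over the piece regrouped by target edge: the product of the turn factors over all
corners over the piece is the product over the edges at the vertex-cells of the factors of their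
two arriving corners (a corner at a non-cell endpoint contributes `1`). [folklore] -/
theorem prod_cornerSet_turnFactor (h : ↥M.freeCells → ℤ) (β : Percolation.BondConfig (Site 2)) :
    ∏ c ∈ Percolation.cornerSet M.piece, M.turnFactor h β c =
      ∏ e ∈ SixVertex.edges M.vertexCells, (M.turnFactor h β (cIn e) * M.turnFactor h β (cOut e)) := by
  classical
  set T := M.turnFactor h β with hT
  -- left: by vertices
  have hL : ∏ c ∈ Percolation.cornerSet M.piece, T c =
      ∏ v ∈ M.vertexCells, (T (toSite v, 0) * T (toSite v, 1) * T (toSite v, 2) * T (toSite v, 3)) := by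
    rw [Percolation.cornerSet, prod_product, piece, prod_image (fun v _ w _ h => toSite_inj.1 h)]
    refine prod_congr rfl fun v _ => ?_
    rw [Fin.prod_univ_four]
  -- right: split into first-endpoint and far-endpoint factors
  have hIn : ∏ e ∈ SixVertex.edges M.vertexCells, T (cIn e) = ∏ v ∈ M.vertexCells, (T (cIn (v, false)) * T (cIn (v, true))) := by
    have hsub : M.vertexCells ×ˢ (univ : Finset Bool) ⊆ SixVertex.edges M.vertexCells := by
      intro e he
      rw [mem_product] at he
      exact (SixVertex.mem_edges_iff _ _).2 (Or.inl he.1)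
    rw [← prod_subset hsub (fun e _ hne => M.turnFactor_cIn_eq_one h β (fun h1 => hne (mem_product.2 ⟨h1, mem_univ _⟩))),
      prod_product]
    refine prod_congr rfl fun v _ => ?_
    rw [Fintype.prod_bool, mul_comm]
  have hOut : ∏ e ∈ SixVertex.edges M.vertexCells, T (cOut e) =
      ∏ v ∈ M.vertexCells, (T (cOut ((v.1 - 1, v.2), false)) * T (cOut ((v.1, v.2 - 1), true))) := by
    set τ : (ℤ × ℤ) × Bool → (ℤ × ℤ) × Bool := fun vb => (if vb.2 then (vb.1.1, vb.1.2 - 1) else (vb.1.1 - 1, vb.1.2), vb.2)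
      with hτ
    have hτtip : ∀ vb, SixVertex.edgeTip (τ vb) = vb.1 := by
      rintro ⟨v, b⟩; cases b <;> simp [hτ, SixVertex.edgeTip]
    have hτinj : Set.InjOn τ ↑(M.vertexCells ×ˢ (univ : Finset Bool)) := by
      rintro ⟨v, b⟩ _ ⟨v', b'⟩ _ hvv
      have hb : b = b' := congrArg Prod.snd hvv
      subst hb
      have := hτtip (v, b)
      rw [hvv, hτtip] at this
      exact Prod.ext this.symm rfl
    have hsub : (M.vertexCells ×ˢ (univ : Finset Bool)).image τ ⊆ SixVertex.edges M.vertexCells := by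
      intro e he
      obtain ⟨vb, hvb, rfl⟩ := mem_image.1 he
      exact (SixVertex.mem_edges_iff _ _).2 (Or.inr (by rw [hτtip]; exact (mem_product.1 hvb).1))
    rw [← prod_subset hsub (fun e _ hne => M.turnFactor_cOut_eq_one h β (fun h1 => hne
      (mem_image.2 ⟨(SixVertex.edgeTip e, e.2), mem_product.2 ⟨h1, mem_univ _⟩, by
        obtain ⟨⟨x, y⟩, d⟩ := e; cases d <;> simp [hτ, SixVertex.edgeTip]⟩))),
      prod_image hτinj, prod_product]
    refine prod_congr rfl fun v _ => ?_
    rw [Fintype.prod_bool, mul_comm]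
    simp only [hτ, Bool.false_eq_true, ↓reduceIte]
    rfl
  rw [hL]
  conv_rhs => rw [prod_mul_distrib, hIn, hOut, ← prod_mul_distrib]
  refine prod_congr rfl fun v _ => ?_
  -- identify the four corners at `v`
  have c0 : cIn (v, true) = (toSite v, 0) := by simp [cIn]
  have c3 : cIn (v, false) = (toSite v, 3) := by simp [cIn]
  have c1 : cOut ((v.1 - 1, v.2), false) = (toSite v, 1) := by
    simp only [cOut, SixVertex.edgeTip, Bool.false_eq_true, ↓reduceIte, sub_add_cancel]
  have c2 : cOut ((v.1, v.2 - 1), true) = (toSite v, 2) := by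
    simp only [cOut, SixVertex.edgeTip, ↓reduceIte, sub_add_cancel]
  rw [c0, c1, c2, c3]
  ring

/-- At a frozen edge the two arriving turn factors, read in the completed configuration of any
`ω ⊆ E`, multiply to the frozen weight. [cite: BaxterKellandWu1976, §4] -/
theorem turnFactor_mul_eq_frozenWeight (h : ↥M.freeCells → ℤ) {ω : Finset ((ℤ × ℤ) × Bool)} (hω : ω ⊆ M.E)
    {e : (ℤ × ℤ) × Bool} (he : e ∈ M.frozenEdges) :
    M.turnFactor h (M.cfgOf ω) (cIn e) * M.turnFactor h (M.cfgOf ω) (cOut e) = M.frozenWeight h e := by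
  have heE : e ∉ M.E := (mem_sdiff.1 he).2
  refine (M.frozenWeight_eq_turnFactor h he ?_).symm
  rw [edgeSym2_mem_cfgOf_iff]
  exact ⟨fun h' => h'.elim (fun hw => absurd (hω hw) heE) id, Or.inr⟩

/-- The pair of arriving turn factors depends on the configuration only through the state of
the edge. [folklore] -/
theorem turnFactor_mul_congr (h : ↥M.freeCells → ℤ) {β β' : Percolation.BondConfig (Site 2)} {e : (ℤ × ℤ) × Bool}
    (hb : edgeSym2 e ∈ β ↔ edgeSym2 e ∈ β') :
    M.turnFactor h β (cIn e) * M.turnFactor h β (cOut e) = M.turnFactor h β' (cIn e) * M.turnFactor h β' (cOut e) := by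
  rw [M.turnFactor_congr h (β := β) (β' := β') (c := cIn e) (by rwa [cTgt_cIn]),
    M.turnFactor_congr h (β := β) (β' := β') (c := cOut e) (by rwa [cTgt_cOut])]

/-- **Weight factorisation over bond configurations.** For a height configuration whose heights
are at unit distance across the four corners of every live edge, the weight of the collar model
is the sum over the bond configurations `ω ⊆ E` of the product over all corners over the piece of
the turn factors in the completed configuration of `ω`: the Baxter–Kelland–Wu expansion of the
six-vertex weights over the two pairings at every live edge. [cite: BaxterKellandWu1976, §3–§4] -/
theorem weight_eq_sum_prod_turnFactor (h : ↥M.freeCells → ℤ)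
    (hunit : ∀ e ∈ M.E, |M.hv h e.1 - M.hf h (SixVertex.leftFace e false)| = 1 ∧
      |M.hv h e.1 - M.hf h (SixVertex.leftFace e true)| = 1 ∧
      |M.hv h (SixVertex.edgeTip e) - M.hf h (SixVertex.leftFace e false)| = 1 ∧
      |M.hv h (SixVertex.edgeTip e) - M.hf h (SixVertex.leftFace e true)| = 1) :
    M.weight h = ∑ ω ∈ M.E.powerset, ∏ c ∈ Percolation.cornerSet M.piece, M.turnFactor h (M.cfgOf ω) c := by
  classical
  set P : (ℤ × ℤ) × Bool → Percolation.BondConfig (Site 2) → ℂ :=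
    fun e β => M.turnFactor h β (cIn e) * M.turnFactor h β (cOut e) with hP
  -- the live factors split, the frozen ones are the frozen weights
  have hlive : ∀ e ∈ M.E, M.liveWeight h e = P e (M.cfgOf {e}) + P e (M.cfgOf ∅) := by
    intro e he
    obtain ⟨v1, v2, v3, v4⟩ := hunit e he
    rw [add_comm]
    refine M.liveWeight_eq_turnFactor_split h he ?_ ?_ v1 v2 v3 v4
    · rw [edgeSym2_mem_cfgOf_iff]; rintro (h' | h')
      · simp at h'
      · exact M.not_mem_openEdges_of_mem_E he h'
    · rw [edgeSym2_mem_cfgOf_iff]; exact Or.inl (mem_singleton_self _)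
  have hfrozen : ∀ e ∈ M.frozenEdges, M.frozenWeight h e = P e (M.cfgOf ∅) := fun e he =>
    (M.turnFactor_mul_eq_frozenWeight h (empty_subset _) he).symm
  have hsub : M.E ⊆ SixVertex.edges M.vertexCells := M.E_subset_edges
  calc M.weight h = (∏ e ∈ M.E, (P e (M.cfgOf {e}) + P e (M.cfgOf ∅))) * ∏ e ∈ M.frozenEdges, P e (M.cfgOf ∅) := by
        rw [weight, prod_congr rfl hlive, prod_congr rfl hfrozen]
    _ = ∑ ω ∈ M.E.powerset, ((∏ e ∈ ω, P e (M.cfgOf {e})) * ∏ e ∈ M.E \ ω, P e (M.cfgOf ∅)) *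
          ∏ e ∈ M.frozenEdges, P e (M.cfgOf ∅) := by rw [prod_add, sum_mul]
    _ = ∑ ω ∈ M.E.powerset, ∏ e ∈ SixVertex.edges M.vertexCells, P e (M.cfgOf ω) := by
        refine sum_congr rfl fun ω hω => ?_
        rw [mem_powerset] at hω
        have h1 : ∏ e ∈ ω, P e (M.cfgOf {e}) = ∏ e ∈ ω, P e (M.cfgOf ω) :=
          prod_congr rfl fun e he => M.turnFactor_mul_congr h (by
            rw [edgeSym2_mem_cfgOf_iff, edgeSym2_mem_cfgOf_iff]
            simp only [mem_singleton, true_or, true_iff]; exact Or.inl he)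
        have h2 : ∏ e ∈ M.E \ ω, P e (M.cfgOf ∅) = ∏ e ∈ M.E \ ω, P e (M.cfgOf ω) :=
          prod_congr rfl fun e he => M.turnFactor_mul_congr h (by
            rw [mem_sdiff] at he
            rw [edgeSym2_mem_cfgOf_iff, edgeSym2_mem_cfgOf_iff]
            simp only [Finset.notMem_empty, false_or]
            exact ⟨Or.inr, fun h' => h'.elim (fun hw => absurd hw he.2) id⟩)
        have h3 : ∏ e ∈ M.frozenEdges, P e (M.cfgOf ∅) = ∏ e ∈ M.frozenEdges, P e (M.cfgOf ω) :=
          prod_congr rfl fun e he => M.turnFactor_mul_congr h (by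
            have heE : e ∉ M.E := (mem_sdiff.1 he).2
            rw [edgeSym2_mem_cfgOf_iff, edgeSym2_mem_cfgOf_iff]
            simp only [Finset.notMem_empty, false_or]
            exact ⟨Or.inr, fun h' => h'.elim (fun hw => absurd (hω hw) heE) id⟩)
        rw [h1, h2, h3, mul_comm (∏ e ∈ ω, _) _, prod_sdiff hω, frozenEdges, mul_comm, prod_sdiff hsub]
    _ = ∑ ω ∈ M.E.powerset, ∏ c ∈ Percolation.cornerSet M.piece, M.turnFactor h (M.cfgOf ω) c :=
        sum_congr rfl fun ω _ => (M.prod_cornerSet_turnFactor h _).symm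

/-- **The partition function as a sum over bond configurations**: if every height configuration
has unit differences around every live edge, `Z = Σ_{ω ⊆ E} Σ_h ∏_c turnFactor h (cfgOf ω) c`.
[cite: BaxterKellandWu1976, §3–§4] -/
theorem Z_eq_sum_prod_turnFactor
    (hunit : ∀ h ∈ M.configs, ∀ e ∈ M.E, |M.hv h e.1 - M.hf h (SixVertex.leftFace e false)| = 1 ∧
      |M.hv h e.1 - M.hf h (SixVertex.leftFace e true)| = 1 ∧
      |M.hv h (SixVertex.edgeTip e) - M.hf h (SixVertex.leftFace e false)| = 1 ∧
      |M.hv h (SixVertex.edgeTip e) - M.hf h (SixVertex.leftFace e true)| = 1) :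
    M.Z = ∑ ω ∈ M.E.powerset, ∑ h ∈ M.configs, ∏ c ∈ Percolation.cornerSet M.piece, M.turnFactor h (M.cfgOf ω) c := by
  rw [Z, sum_congr rfl (fun h hh => M.weight_eq_sum_prod_turnFactor h (hunit h hh)), sum_comm]

end Factorisation

end CollarLegModel

end Literature.Probability.LatticeModels
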